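import Summits.QuantumFields.BalabanUV.T4Continuum.Support.NE7K1LinBoxThm110DerivStep

/-!
# NE7K1LinBoxThm110Deriv — row NE7 (node U5), candidate route HOM, path H1L, cell K1-lin(s): card §3y STEP 7, PART 7 —
# B4 THEOREM (1.10), DERIVATIVE CLAUSE, FOR THE TWO-CUTOFF LINE ON NEUMANN BOXES AT `A = 0`, EVERY SCALE `k ≥ 1`, EVERY `s ∈ [0,1]`:
# `Σ_{x′}|η^{−1}(G^Π_k(s; x+ηe_μ, x′) − G^Π_k(s; x, x′))|·e^{δ₀dist(x,x′)} ≤ c₀`, `(c₀, δ₀)` IN `(d, L, a±)` ONLY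

Lineage `b2b-balaban-t4-ne7-p2` (CRUX PROVER NE7 #2), generation 79; file 100.  b04's `B4Thm110ZeroBoxDeriv` §5–§6 re-run on the line's
tower (files 95–99): the induction over `j` for the `L^k`-scaled differenced rows (base = file 95's `boxLine_L_inv_decay` differenced
crudely, `L^k·s_1^{−2} ≤ L` = b04's `Lk_mul_sc_one_sq_inv_le`; step = file 99's `step_termD_bound_line`; `Σ_j L^{−(k−j)} ≤ 1`), then the
weighted-row DERIVATIVE CLAUSE for `G^Π_k(s) = (boxLine(L^k, M, a_k, s))⁻¹`.

* §1 **`GfineL_rowwD_bound`**; §2 **`thm110_line_box_deriv_roww`**.  The printed forms (`‖f‖_∞`, `dist(x, supp f)`, Lemma 2.2 for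
  `D^η_μG^Π_k(s)` and `G^Π_k(s)D^{η*}_μ`, the literal coefficient `a`) are file 101.
CONSTANTS: `(δ₀, c₀)` existential, closed terms in `(d, ℓ, a₋, a₊)` — NO `s`, `k`, box, `μ` ((k1)); `s` enters only through `0 ≤ s ≤ 1`.

HONEST FRAMING: [folklore]; A = 0; the LINE is not in [B4] — the print's box route transposed; nothing of Bałaban's asserted; no
`sorry`.  Census only (STEP 7, derivative clause); NE7 NOT PRINTED ∕ NOT PROVED; spine 0∕9; FIXED FINITE T⁴, rung (B)+1; NOT infinite
volume, NOT mass gap, NOT Clay.  HONEST DEPENDENCY: continuum YM on T⁴ ⇐ BetaPertH ∧ nine spine estimates (0/9 proved); BetaPertH ⇐ (D1)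
∧ (D4) ∧ CAP+tail; G-an2-4 gates asym, D1 and NE2/3/4.
-/

noncomputable section

open Finset Matrix

namespace Summit.QuantumFields.BalabanUV.T4Continuum.NE7K1LinBoxThm110Deriv

open Literature.MathematicalPhysics.QuantumFieldTheory.Balaban1983to89
open Literature.MathematicalPhysics.QuantumFieldTheory.Balaban1983to89.B4Reflection242
open Literature.MathematicalPhysics.QuantumFieldTheory.Balaban1983to89.B4Lower18
open Literature.MathematicalPhysics.QuantumFieldTheory.Balaban1983to89.B4ContourShift (supNorm supNorm_nonneg)
open Literature.MathematicalPhysics.QuantumFieldTheory.Balaban1983to89.B4BoxCov237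
open Literature.MathematicalPhysics.QuantumFieldTheory.Balaban1983to89.B4Thm110ZeroBox
open Literature.MathematicalPhysics.QuantumFieldTheory.Balaban1983to89.B4Thm110ZeroBoxDeriv
open Literature.MathematicalPhysics.QuantumFieldTheory.Balaban1983to89.B4Sect5Proof (latticeConst latticeConst_nonneg latticeSum_le)
open NE7K1LinSchurLineU1 NE7K1LinSchurFoldBox NE7K1LinBoxCovEnergy NE7K1LinLineLaplacian NE7K1LinBoxCov237 NE7K1LinBoxScales
open NE7K1LinBoxRGStep NE7K1LinBoxThm110Step NE7K1LinBoxThm110DerivStep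

variable {d : ℕ}

/-! ### §1 The induction over `j`: `Σ_{x′}L^k|𝒢_j(s)(xe,x′) − 𝒢_j(s)(x,x′)|e^{δ₀|x−x′|/L^k} ≤ B + Θe^{δ₀}Σ_{i<j}L^{-(k-i)}` -/

set_option maxHeartbeats 800000 in
/-- **UNIFORM WEIGHTED BOUND FOR THE DIFFERENCED ROWS OF ALL THE LINE's PROPAGATORS `𝒢_j(s)`, `1 ≤ j ≤ k`**: there are `δ₀ > 0`,
`c₀ > 0` (depending on `d, ℓ` and the window `[a₋,a₊]` only) with `Σ_{x′}L^k|𝒢_j(s)(x+e_μ,x′) − 𝒢_j(s)(x,x′)|e^{δ₀|x−x′|_∞/L^k} ≤ c₀` for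
every box, every `k ≥ 1`, every `1 ≤ j ≤ k`, EVERY `s ∈ [0,1]`, every axis `μ` and every pair of neighbours `x, x+e_μ` of the fine box —
induction over `j` from the base (file 95's one-step box line `boxLine_L_inv_decay`, differenced crudely: `|∇| ≤ 2` entries,
`L^k·s_1^{-2} ≤ L`) with the summable steps of file 99 (`Σ_jL^{-(k-j)} ≤ 1`); b04's `Gfine_rowwD_bound` re-run. [folklore] -/
theorem GfineL_rowwD_bound (d ℓ : ℕ) (hℓ : 1 ≤ ℓ) (amin aplus : ℝ) (ha : 0 < amin) :
    ∃ δ₀ c₀ : ℝ, 0 < δ₀ ∧ 0 < c₀ ∧ ∀ (k : ℕ), 1 ≤ k → ∀ (j : ℕ), 1 ≤ j → j ≤ k →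
      ∀ (a s : ℝ), amin ≤ a → a ≤ aplus → 0 ≤ s → s ≤ 1 → ∀ (M : Fin (d + 1) → ℕ),
        (∀ i, 1 ≤ M i) → ∀ (μ : Fin (d + 1)) (x xe : ↥(boxDom (Nf ℓ k M))), xe.1 = x.1 + Pi.single μ 1 →
          wsum δ₀ ((ℓ + 1) ^ k) x (fun x' => (((ℓ + 1) ^ k : ℕ) : ℝ) *
              (GfineL ℓ k M j a s xe x' - GfineL ℓ k M j a s x x')) ≤ c₀ := by
  obtain ⟨r, C₀, hr, hC₀, hdec⟩ := boxLine_L_inv_decay d ℓ (amin * (1 - ((((ℓ : ℝ) + 1)) ^ 2)⁻¹))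
    aplus (aminus'_pos hℓ ha)
  obtain ⟨κ₀, Θ, hκ₀, hΘ, hstep⟩ := step_termD_bound_line d ℓ hℓ amin aplus ha
  set δ₀ : ℝ := min (r / 2) κ₀ with hδ₀
  have hδ0 : 0 < δ₀ := lt_min (half_pos hr) hκ₀
  have hδr : δ₀ ≤ r / 2 := min_le_left _ _
  have hδκ : δ₀ ≤ κ₀ := min_le_right _ _
  have hK1 := one_le_latticeConst d (half_pos hr)
  have hL0 : (0 : ℝ) < (ℓ : ℝ) + 1 := by positivity
  set B₁ : ℝ := ((ℓ : ℝ) + 1) * C₀ * (Real.exp r + 1) * latticeConst (d + 1) (r / 2) with hB₁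
  have hB₁0 : 0 < B₁ := by positivity
  refine ⟨δ₀, B₁ + Θ * Real.exp δ₀, hδ0, by positivity, ?_⟩
  intro k hk j hj1 hjk a s h1 h2 h3 h4 M hM
  have ha0 : 0 < a := lt_of_lt_of_le ha h1
  have hL := one_lt_L_real hℓ
  set q : ℝ := (((ℓ : ℝ) + 1))⁻¹ with hq
  have hL2 : (2 : ℝ) ≤ (ℓ : ℝ) + 1 := by
    have : (1 : ℝ) ≤ ℓ := by exact_mod_cast hℓ
    linarith
  have hq0 : 0 < q := by positivity
  have hq2 : q ≤ 1 / 2 := by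
    rw [hq]
    calc (((ℓ : ℝ) + 1))⁻¹ ≤ (2 : ℝ)⁻¹ := inv_anti₀ (by norm_num) hL2
      _ = 1 / 2 := by norm_num
  have hq1 : 0 < 1 - q := by linarith
  have hnk : 1 ≤ (ℓ + 1) ^ k := Nat.one_le_pow _ _ (by omega)
  have hn0 : (0 : ℝ) ≤ (((ℓ + 1) ^ k : ℕ) : ℝ) := Nat.cast_nonneg _
  -- the base: entries of `𝒢_1`, scaled by `L^k`
  obtain ⟨hw1, hw2, hapos⟩ := aSeq_window hℓ ha h1 h2 (le_refl 1)
  have hT : ∀ p q' : ↥(boxDom (Nf ℓ k M)),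
      (((ℓ + 1) ^ k : ℕ) : ℝ) * |GfineL ℓ k M 1 a s p q'|
        ≤ ((ℓ : ℝ) + 1) * C₀ * Real.exp (-(r * supNorm (p.1 - q'.1))) := by
    intro p q'
    rcases Nat.lt_or_ge k 2 with hk2 | hk2
    · obtain rfl : k = 1 := by omega
      rw [GfineL_top]
      have hd := hdec ((ℓ + 1) ^ 1) (Nat.one_le_pow 1 (ℓ + 1) (Nat.succ_pos ℓ)) (pow_one _) _ _ hw1 hw2 h3 h4 M p q'
      have hc1 : (((ℓ + 1) ^ 1 : ℕ) : ℝ) = (ℓ : ℝ) + 1 := by push_cast; ring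
      rw [hc1, mul_assoc]
      exact mul_le_mul_of_nonneg_left hd hL0.le
    · have hs : 0 < sc ℓ k 1 ^ 2 := pow_pos (sc_pos ℓ k 1) 2
      rw [GfineL_apply hℓ (le_refl 1) hk2 hM ha0 h3 h4 p q', abs_mul, abs_of_pos (inv_pos.2 hs), ← mul_assoc]
      have hd := hdec (bj ℓ 1) (bj_pos ℓ 1) (pow_one _) _ _ hw1 hw2 h3 h4 (Mj ℓ k M 1)
        ((ej ℓ k M 1 hk2).symm p) ((ej ℓ k M 1 hk2).symm q')
      calc (((ℓ + 1) ^ k : ℕ) : ℝ) * (sc ℓ k 1 ^ 2)⁻¹ *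
            |(boxLine (ℓ + 1) (bj_pos ℓ 1) (Mj ℓ k M 1) (B1.aSeq a ((ℓ : ℝ) + 1) 1) s)⁻¹
              ((ej ℓ k M 1 hk2).symm p) ((ej ℓ k M 1 hk2).symm q')|
          ≤ ((ℓ : ℝ) + 1) * (C₀ * Real.exp (-(r * supNorm (p.1 - q'.1)))) :=
            mul_le_mul (Lk_mul_sc_one_sq_inv_le hk) hd (abs_nonneg _) hL0.le
        _ = _ := by ring
  -- the base: the differenced rows
  have hTD : ∀ (μ : Fin (d + 1)) (x xe : ↥(boxDom (Nf ℓ k M))), xe.1 = x.1 + Pi.single μ 1 →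
      ∀ x', |(((ℓ + 1) ^ k : ℕ) : ℝ) * (GfineL ℓ k M 1 a s xe x' - GfineL ℓ k M 1 a s x x')|
        ≤ ((ℓ : ℝ) + 1) * C₀ * (Real.exp r + 1) * Real.exp (-(r * supNorm (x.1 - x'.1))) := by
    intro μ x xe hxe x'
    have h1' := hT xe x'
    have h2' := hT x x'
    have hnb := supNorm_sub_le_nbr (x' := x'.1) hxe
    have he : Real.exp (-(r * supNorm (xe.1 - x'.1))) ≤ Real.exp r * Real.exp (-(r * supNorm (x.1 - x'.1))) := by
      rw [← Real.exp_add]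
      exact Real.exp_le_exp.2 (by nlinarith)
    have hLC : 0 ≤ ((ℓ : ℝ) + 1) * C₀ := by positivity
    calc |(((ℓ + 1) ^ k : ℕ) : ℝ) * (GfineL ℓ k M 1 a s xe x' - GfineL ℓ k M 1 a s x x')|
        = (((ℓ + 1) ^ k : ℕ) : ℝ) * |GfineL ℓ k M 1 a s xe x' - GfineL ℓ k M 1 a s x x'| := by
          rw [abs_mul, abs_of_nonneg hn0]
      _ ≤ (((ℓ + 1) ^ k : ℕ) : ℝ) * (|GfineL ℓ k M 1 a s xe x'| + |GfineL ℓ k M 1 a s x x'|) :=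
          mul_le_mul_of_nonneg_left (abs_sub _ _) hn0
      _ = (((ℓ + 1) ^ k : ℕ) : ℝ) * |GfineL ℓ k M 1 a s xe x'|
            + (((ℓ + 1) ^ k : ℕ) : ℝ) * |GfineL ℓ k M 1 a s x x'| := mul_add _ _ _
      _ ≤ ((ℓ : ℝ) + 1) * C₀ * Real.exp (-(r * supNorm (xe.1 - x'.1)))
            + ((ℓ : ℝ) + 1) * C₀ * Real.exp (-(r * supNorm (x.1 - x'.1))) := add_le_add h1' h2'
      _ ≤ ((ℓ : ℝ) + 1) * C₀ * (Real.exp r * Real.exp (-(r * supNorm (x.1 - x'.1))))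
            + ((ℓ : ℝ) + 1) * C₀ * Real.exp (-(r * supNorm (x.1 - x'.1))) :=
          add_le_add (mul_le_mul_of_nonneg_left he hLC) le_rfl
      _ = _ := by ring
  -- the inductive claim
  have main : ∀ j, 1 ≤ j → j ≤ k → ∀ (μ : Fin (d + 1)) (x xe : ↥(boxDom (Nf ℓ k M))),
      xe.1 = x.1 + Pi.single μ 1 →
      wsum δ₀ ((ℓ + 1) ^ k) x (fun x' => (((ℓ + 1) ^ k : ℕ) : ℝ) *
          (GfineL ℓ k M j a s xe x' - GfineL ℓ k M j a s x x'))
        ≤ B₁ + Θ * Real.exp δ₀ * (q * (sc ℓ k j)⁻¹ / (1 - q)) := by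
    intro j hj1
    induction j, hj1 using Nat.le_induction with
    | base =>
      intro _ μ x xe hxe
      have hB0 : 0 ≤ ((ℓ : ℝ) + 1) * C₀ * (Real.exp r + 1) := by positivity
      calc wsum δ₀ ((ℓ + 1) ^ k) x (fun x' => (((ℓ + 1) ^ k : ℕ) : ℝ) *
              (GfineL ℓ k M 1 a s xe x' - GfineL ℓ k M 1 a s x x'))
          ≤ ((ℓ : ℝ) + 1) * C₀ * (Real.exp r + 1) * latticeConst (d + 1) (r / 2) :=
            wsum_le_of_decay hnk x hB0 hr hδ0.le hδr (hTD μ x xe hxe)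
        _ ≤ B₁ + Θ * Real.exp δ₀ * (q * (sc ℓ k 1)⁻¹ / (1 - q)) := by
            rw [hB₁]
            have : 0 ≤ Θ * Real.exp δ₀ * (q * (sc ℓ k 1)⁻¹ / (1 - q)) := by
              have := sc_pos ℓ k 1
              positivity
            linarith
    | succ j hj1 ih =>
      intro hjk μ x xe hxe
      have hprev := ih (by omega) μ x xe hxe
      have hst := hstep δ₀ hδ0.le hδκ k j hj1 hjk a s h1 h2 h3 h4 M hM μ x xe hxe
      have hsplit : (fun x' => (((ℓ + 1) ^ k : ℕ) : ℝ) *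
            (GfineL ℓ k M (j + 1) a s xe x' - GfineL ℓ k M (j + 1) a s x x'))
          = fun x' => (((ℓ + 1) ^ k : ℕ) : ℝ) *
              ((GfineL ℓ k M (j + 1) a s - GfineL ℓ k M j a s) xe x'
                - (GfineL ℓ k M (j + 1) a s - GfineL ℓ k M j a s) x x')
            + (((ℓ + 1) ^ k : ℕ) : ℝ) * (GfineL ℓ k M j a s xe x' - GfineL ℓ k M j a s x x') := by
        funext x'
        simp only [Matrix.sub_apply]
        ring
      rw [hsplit]
      calc wsum δ₀ ((ℓ + 1) ^ k) x (fun x' => (((ℓ + 1) ^ k : ℕ) : ℝ) *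
              ((GfineL ℓ k M (j + 1) a s - GfineL ℓ k M j a s) xe x'
                - (GfineL ℓ k M (j + 1) a s - GfineL ℓ k M j a s) x x')
            + (((ℓ + 1) ^ k : ℕ) : ℝ) * (GfineL ℓ k M j a s xe x' - GfineL ℓ k M j a s x x'))
          ≤ wsum δ₀ ((ℓ + 1) ^ k) x (fun x' => (((ℓ + 1) ^ k : ℕ) : ℝ) *
              ((GfineL ℓ k M (j + 1) a s - GfineL ℓ k M j a s) xe x'
                - (GfineL ℓ k M (j + 1) a s - GfineL ℓ k M j a s) x x'))
            + wsum δ₀ ((ℓ + 1) ^ k) x (fun x' => (((ℓ + 1) ^ k : ℕ) : ℝ) *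
              (GfineL ℓ k M j a s xe x' - GfineL ℓ k M j a s x x')) := wsum_add_le _ _ _ _ _
        _ ≤ Θ * Real.exp δ₀ * (sc ℓ k j)⁻¹ + (B₁ + Θ * Real.exp δ₀ * (q * (sc ℓ k j)⁻¹ / (1 - q))) :=
            add_le_add hst hprev
        _ = B₁ + Θ * Real.exp δ₀ * (q * (sc ℓ k (j + 1))⁻¹ / (1 - q)) := by
            rw [sc_inv_succ hjk, ← hq]
            field_simp
            ring
  intro μ x xe hxe
  have hm := main j hj1 hjk μ x xe hxe
  have hs1 : (sc ℓ k j)⁻¹ ≤ 1 := inv_le_one_of_one_le₀ (one_le_sc ℓ k j)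
  have hs0 : 0 < (sc ℓ k j)⁻¹ := inv_pos.2 (sc_pos ℓ k j)
  have hgeo : q * (sc ℓ k j)⁻¹ / (1 - q) ≤ 1 := by
    rw [div_le_one hq1]
    calc q * (sc ℓ k j)⁻¹ ≤ q * 1 := mul_le_mul_of_nonneg_left hs1 hq0.le
      _ ≤ 1 - q := by linarith
  have hΘe : 0 ≤ Θ * Real.exp δ₀ := by positivity
  have hfin := mul_le_of_le_one_right hΘe hgeo
  linarith

/-! ### §2 THEOREM (1.10) of [B4], DERIVATIVE CLAUSE, FOR THE TWO-CUTOFF LINE on boxes: the decay of `D^η_μG^Π_k(s)` -/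

/-- **[B4] p. 573 THEOREM, inequality (1.10), DERIVATIVE CLAUSE `|(D^η_μ G f)(x)|`, FOR THE TWO-CUTOFF LINE at `A = 0` on
rectangular parallelepipeds** (weighted-row form): there are `δ₀ > 0`, `c₀ > 0` depending only on `d`, `L = ℓ + 1` and the window
`[a₋,a₊]` such that for every `k ≥ 1` (`η = L^{-k}`), every `a` in the window, EVERY `s ∈ [0,1]`, every box `□ = Π_μ[0, M_μ)` (`M_μ ≥ 1`),
every axis `μ` and every pair of fine-lattice neighbours `x, xe = x + ηe_μ` in `□`:
`Σ_{x′ ∈ □} |η^{-1}(G^Π_k(s; x + ηe_μ, x′) − G^Π_k(s; x, x′))|·e^{δ₀·dist(x,x′)} ≤ c₀`, `G^Π_k(s) = (boxLine(L^k, M, a_k, s))⁻¹ =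
(T^Π(s) + a_kQ_k^*Q_k)⁻¹` the line's propagator on the Neumann box (values form), `dist = |·|_∞/L^k`.  HONEST LABEL: the LINE is not
in [B4]; proved by the print's box route (2.34)/(2.38)–(2.39) transposed to the line (files 94–99).
[cite: Balaban1983RegularityDecay, p. 573 Theorem (1.10); p. 582 (2.34)–(2.35), (2.38)–(2.39), for the two-cutoff line] -/
theorem thm110_line_box_deriv_roww (d ℓ : ℕ) (hℓ : 1 ≤ ℓ) (amin aplus : ℝ) (ha : 0 < amin) :
    ∃ δ₀ c₀ : ℝ, 0 < δ₀ ∧ 0 < c₀ ∧ ∀ (k : ℕ), 1 ≤ k → ∀ (a s : ℝ), amin ≤ a → a ≤ aplus → 0 ≤ s →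
      s ≤ 1 → ∀ (M : Fin (d + 1) → ℕ), (∀ i, 1 ≤ M i) →
        ∀ (μ : Fin (d + 1)) (x xe : ↥(boxDom (fun i => (ℓ + 1) ^ k * M i))), xe.1 = x.1 + Pi.single μ 1 →
          ∑ x', |(((ℓ + 1) ^ k : ℕ) : ℝ) *
                ((boxLine (ℓ + 1) (Nat.one_le_pow k (ℓ + 1) (Nat.succ_pos ℓ)) M (B1.aSeq a ((ℓ : ℝ) + 1) k) s)⁻¹ xe x'
                  - (boxLine (ℓ + 1) (Nat.one_le_pow k (ℓ + 1) (Nat.succ_pos ℓ)) M (B1.aSeq a ((ℓ : ℝ) + 1) k) s)⁻¹ x x')|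
              * Real.exp (δ₀ * supNorm (x.1 - x'.1) / (((ℓ + 1) ^ k : ℕ) : ℝ)) ≤ c₀ := by
  obtain ⟨δ₀, c₀, hδ, hc, h⟩ := GfineL_rowwD_bound d ℓ hℓ amin aplus ha
  refine ⟨δ₀, c₀, hδ, hc, fun k hk a s h1 h2 h3 h4 M hM μ x xe hxe => ?_⟩
  have hG : GfineL ℓ k M k a s = (boxLine (ℓ + 1) (Nat.one_le_pow k (ℓ + 1) (Nat.succ_pos ℓ)) M (B1.aSeq a ((ℓ : ℝ) + 1) k) s)⁻¹ :=
    GfineL_top ℓ k M a s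
  have := h k hk k hk le_rfl a s h1 h2 h3 h4 M hM μ x xe hxe
  rw [wsum, hG] at this
  exact this


end Summit.QuantumFields.BalabanUV.T4Continuum.NE7K1LinBoxThm110Deriv

end
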